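import Summits.AtomisticToContinuum.HydrodynamicLimit.Theorems.JParityClosureLocalSecondLawEquilibriumConst

/-!
# The crux `JParityClosure.LocalSecondLaw` on the constant-data slice, in the crux's own vocabulary (lead c3)

`localSecondLaw_constData`: the body of `Summit.AtomisticToContinuum.HydrodynamicLimit.Theses.JParityClosure.LocalSecondLaw`
BYTE-FOR-BYTE (the `let`-bound cone fields, the guarded entropy with `hsExcessFreeEnergy`, the filed limit order), with the three
continuity hypotheses on the initial profiles `(a₀, θ₀, u₀)` replaced by CONSTANCY.  It is the landed equilibrium instance
`localSecondLaw_const` (file `JParityClosureLocalSecondLawEquilibriumConst.lean`) read through the definitional identities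
`lawC σ a Θ ū N Φ = localGibbsLaw σ (fun _ => a) (fun _ => ū) (fun _ => Θ) N Φ` and `entropyFunctional = I` — so that the claim
"the crux holds verbatim at global equilibrium, for every horizon `τ`" is kernel-checked against the route declaration's text
rather than against the line's abbreviations.

Reference: H. Spohn, *Large Scale Dynamics of Interacting Particles* (1991), Part I §2.3.
-/

noncomputable section

open scoped BigOperators Topology Classical MeasureTheory ENNReal InnerProductSpace
open Filter Set MeasureTheory Literature.MathematicalPhysics.KineticTheory Literature.Analysis.FluidPDE

namespace Summit.AtomisticToContinuum.HydrodynamicLimit.Theorems.LocalSecondLawEquilibrium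

open Summit.AtomisticToContinuum.HydrodynamicLimit.Theorems.LocalSecondLawNegative
  Summit.AtomisticToContinuum.HydrodynamicLimit.Theorems.LocalSecondLawLedger

/-- **The local second law on the constant-data slice, verbatim** (registered stub `localSecondLaw_constData`): the body of the
crux `JParityClosure.LocalSecondLaw` with `Continuous a₀ → Continuous θ₀ → Continuous u₀` replaced by
`(∃ a, a₀ = fun _ => a) → (∃ Θ, θ₀ = fun _ => Θ) → (∃ ū, u₀ = fun _ => ū)`; everything after is the route text unchanged
(global equilibrium, every horizon `τ`, full hard-sphere entropy, the guard, the limit order `r → 0` after `N → ∞`). -/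
theorem localSecondLaw_constData : ∀ (a₀ θ₀ : Literature.MathematicalPhysics.KineticTheory.T3 → ℝ) (u₀ : Literature.MathematicalPhysics.KineticTheory.T3 → Literature.MathematicalPhysics.KineticTheory.V3), (∃ a : ℝ, a₀ = fun _ => a) → (∃ Θ : ℝ, θ₀ = fun _ => Θ) → (∃ ū : Literature.MathematicalPhysics.KineticTheory.V3, u₀ = fun _ => ū) → (∀ x, 0 < a₀ x) → (∀ x, 0 < θ₀ x) → ∃ σ₀ : ℝ, 0 < σ₀ ∧ ∀ σ : ℝ, 0 < σ → σ < σ₀ → ∀ (T : ℝ) (ρ θ : ℝ → Literature.MathematicalPhysics.KineticTheory.T3 → ℝ) (u : ℝ → Literature.MathematicalPhysics.KineticTheory.T3 → Literature.MathematicalPhysics.KineticTheory.V3), Literature.MathematicalPhysics.KineticTheory.IsHardSphereEulerSolution σ T ρ u θ → ∀ Φ : (N : ℕ) → Literature.Analysis.FluidPDE.HardSphereFlow (Literature.Analysis.FluidPDE.Torus.geometry (Fin 3)) (Literature.MathematicalPhysics.KineticTheory.hsDiameter σ N) (N + 1), Literature.MathematicalPhysics.KineticTheory.TendstoHydroFieldsAt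 (fun N => Literature.MathematicalPhysics.KineticTheory.localGibbsLaw σ a₀ u₀ θ₀ N (Φ N)) Φ ρ u θ 0 → 0 < T → ∀ τ : ℝ, 0 < τ → ∀ φ : ℝ → Literature.MathematicalPhysics.KineticTheory.T3 → ℝ, Literature.Analysis.FunctionSpaces.Torus.IsSmoothSpaceTimeOn Set.univ φ → (∀ s x, 0 ≤ φ s x) → (∃ τ' : ℝ, τ' < τ ∧ ∀ s, τ' ≤ s → ∀ x, φ s x = 0) → ∀ η δ : ℝ, 0 < η → 0 < δ → ∃ r₀ : ℝ, 0 < r₀ ∧ ∀ r : ℝ, 0 < r → r < r₀ → ∃ N₀ : ℕ, ∀ N : ℕ, N₀ ≤ N → let γ : Literature.Analysis.FluidPDE.Config (N + 1) (Fin 3) Literature.MathematicalPhysics.KineticTheory.T3 → ℝ → Literature.Analysis.FluidPDE.Config (N + 1) (Fin 3) Literature.MathematicalPhysics.KineticTheory.T3 := fun z s => (Φ N).flow s z; let bx : Literature.MathematicalPhysics.KineticTheory.T3 → Literature.MathematicalPhysics.KineticTheory.T3 → ℝ := fun x y => 3 / (Real.pi * r ^ 3) * max (1 - Literature.Analysis.FluidPDE.Torus.euclidDist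 x y / r) 0; let ρm : Literature.Analysis.FluidPDE.Config (N + 1) (Fin 3) Literature.MathematicalPhysics.KineticTheory.T3 → ℝ → Literature.MathematicalPhysics.KineticTheory.T3 → ℝ := fun z s x₀ => ∫ q, bx q.1 x₀ ∂(Literature.Analysis.FluidPDE.empiricalMeasure (γ z s)); let mm : Literature.Analysis.FluidPDE.Config (N + 1) (Fin 3) Literature.MathematicalPhysics.KineticTheory.T3 → ℝ → Literature.MathematicalPhysics.KineticTheory.T3 → Literature.MathematicalPhysics.KineticTheory.V3 := fun z s x₀ => ∫ q, bx q.1 x₀ • q.2 ∂(Literature.Analysis.FluidPDE.empiricalMeasure (γ z s)); let em : Literature.Analysis.FluidPDE.Config (N + 1) (Fin 3) Literature.MathematicalPhysics.KineticTheory.T3 → ℝ → Literature.MathematicalPhysics.KineticTheory.T3 → ℝ := fun z s x₀ => ∫ q, bx q.1 x₀ * (‖q.2‖ ^ 2 / 2) ∂(Literature.Analysis.FluidPDE.empiricalMeasure (γ z s)); let θm : Literature.Analysis.FluidPDE.Config (N + 1) (Fin 3) Literature.MathematicalPhysics.KineticTheory.T3 → ℝ → Literature.MathematicalPhysics.KineticTheory.T3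 → ℝ := fun z s x₀ => 2 / 3 * (em z s x₀ / ρm z s x₀ - ‖mm z s x₀‖ ^ 2 / (2 * ρm z s x₀ ^ 2)); let Hs : ℝ → ℝ → ℝ := fun a b => if 0 < a ∧ 0 < b then -(a * (3 / 2 * Real.log b - Real.log a - Literature.MathematicalPhysics.KineticTheory.hsExcessFreeEnergy (a * σ ^ 3))) else 0; let I : Literature.Analysis.FluidPDE.Config (N + 1) (Fin 3) Literature.MathematicalPhysics.KineticTheory.T3 → ℝ := fun z => ∫ s in Set.Icc (0 : ℝ) τ, ∫ x : Literature.MathematicalPhysics.KineticTheory.T3, Hs (ρm z s x) (θm z s x) * (deriv (fun s' => φ s' x) s + ∑ k : Fin 3, (mm z s x) k / ρm z s x * Literature.Analysis.FunctionSpaces.Torus.partialDeriv k (φ s) x); Literature.MathematicalPhysics.KineticTheory.localGibbsLaw σ a₀ u₀ θ₀ N (Φ N) {z | I z + ∫ x : Literature.MathematicalPhysics.KineticTheory.T3, Hs (ρ 0 x) (θ 0 x) * φ 0 x < -η} ≤ ENNReal.ofReal δ := by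
  rintro a₀ θ₀ u₀ ⟨a, rfl⟩ ⟨Θ, rfl⟩ ⟨ū, rfl⟩ ha0 hθ0
  have ha : 0 < a := ha0 0
  have hΘ : 0 < Θ := hθ0 0
  obtain ⟨σ₀, hσ₀, H⟩ := localSecondLaw_const a Θ ū ha hΘ
  refine ⟨σ₀, hσ₀, fun σ hσ hσlt T ρ θ u hE Φ h0 hT τ hτ φ hφ hφ0 hsupp η δ hη hδ => ?_⟩
  obtain ⟨r₀, hr₀, H'⟩ := H σ hσ hσlt T ρ θ u hE Φ h0 hT τ hτ φ hφ hφ0 hsupp η δ hη hδ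
  refine ⟨r₀, hr₀, fun r hr hrlt => ?_⟩
  obtain ⟨N₀, H''⟩ := H' r hr hrlt
  exact ⟨N₀, fun N hN => H'' N hN⟩

end Summit.AtomisticToContinuum.HydrodynamicLimit.Theorems.LocalSecondLawEquilibrium

end
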